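import Summits.KontsevichZagierPeriods.KontsevichZagierPeriods.Theorems.StuffleInKZ.Negative.Core

/-!
# `StuffleInKZ` (stmt-3931), negative side, cycle 3 Part II — the one-variable iterated integrals
# behind the first-axis marginals of `Δ₄`, `Δ_{2,2}` and `Δ₂ × Δ₂`

For `0 ≤ x ≤ 1` and a binary word `ε`, `Λ_ε(x) = ∫⁻_{x > t₀ > ⋯ > 0} ∏ ω_{εᵢ}(tᵢ)` (lower Lebesgue
integral, the tree's `KZ.MZVSimplex` set-up of `MZVSimplexRepFubini.lean`). Computed here as
`ℝ≥0∞`-power series, by the tree's slicing `wordLIntegral_cons` and one-variable steps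
`lintegral_inv_mul_tsum` (letter `0`) / `lintegral_inv_one_sub_mul_tsum` (letter `1`):

* `ellE x = Λ_{1}(x)   = Σ_m x^{m+1}/(m+1)`            (`= −log(1−x)`, `ellE_eq_ofReal_neg_log`);
* `li2E x = Λ_{01}(x)  = Σ_m x^{m+1}/(m+1)²`;
* `li3E x = Λ_{001}(x) = Σ_m x^{m+1}/(m+1)³`           (tail word of `ε(4) = 0001`);
* `li12E x = Λ_{101}(x) = Σ_{m,k} x^{m+k+2}/((m+1)²(m+k+2))` (tail word of `ε(2,2) = 0101`).

[Zagier 1994, §9] [folklore].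
-/

noncomputable section

namespace Summit.KontsevichZagierPeriods.Theorems.StuffleInKZ.Negative

namespace Series

open MeasureTheory Set Filter ENNReal
open Literature.NumberTheory.Transcendental
open Literature.NumberTheory.Transcendental.KZ
open Literature.NumberTheory.Transcendental.KZ.MZVSimplex

/-- The word integral `Λ_ε^w(x)` (notation only; the tree writes it out). -/
abbrev wordLI (ε : List Bool) (w : ℕ) (x : ℝ) : ℝ≥0∞ :=
  ∫⁻ t in {t : Fin w → ℝ | (∀ i, 0 < t i) ∧ (∀ i, t i < x) ∧ StrictAnti t},
    ∏ i : Fin w, ENNReal.ofReal (mzvForm (ε.getD i false) (t i))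

/-- `ℓ(x) = Σ_m x^{m+1}/(m+1)` in `ℝ≥0∞`. -/
def ellE (x : ℝ) : ℝ≥0∞ := ∑' m : ℕ, ENNReal.ofReal (x ^ (m + 1) / (m + 1))

/-- `Li₂(x) = Σ_m x^{m+1}/(m+1)²` in `ℝ≥0∞`, written as `(1/(m+1)) · (x^{m+1}/(m+1))`. -/
def li2E (x : ℝ) : ℝ≥0∞ :=
  ∑' m : ℕ, ENNReal.ofReal (1 / (m + 1)) * ENNReal.ofReal (x ^ (m + 1) / (m + 1))

/-- `Li₃(x) = Σ_m x^{m+1}/(m+1)³` in `ℝ≥0∞`, written as `(1/(m+1)²) · (x^{m+1}/(m+1))`. -/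
def li3E (x : ℝ) : ℝ≥0∞ :=
  ∑' m : ℕ, ENNReal.ofReal (1 / (m + 1) ^ 2) * ENNReal.ofReal (x ^ (m + 1) / (m + 1))

/-- `Li_{1,2}(x) = Σ_{m,k} x^{m+k+2}/((m+1)²(m+k+2))` in `ℝ≥0∞`. -/
def li12E (x : ℝ) : ℝ≥0∞ :=
  ∑' p : ℕ × ℕ, ENNReal.ofReal (1 / (p.1 + 1) ^ 2) *
    ENNReal.ofReal (x ^ (p.1 + 1 + p.2 + 1) / ((p.1 + 1 + p.2 + 1 : ℕ) : ℝ))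

/-! ### The letter `1` on the empty word: `Λ_1(x) = ℓ(x)` -/

/-- `∫⁻_{(0,x)} dt/(1−t) = Σ_m x^{m+1}/(m+1)` for `0 ≤ x ≤ 1`. [folklore] -/
theorem lintegral_inv_one_sub {x : ℝ} (hx0 : 0 ≤ x) (hx1 : x ≤ 1) :
    ∫⁻ t in Ioo 0 x, ENNReal.ofReal (1 / (1 - t)) = ellE x := by
  calc ∫⁻ t in Ioo 0 x, ENNReal.ofReal (1 / (1 - t))
      = ∫⁻ t in Ioo 0 x, ∑' m : ℕ, ENNReal.ofReal (t ^ m) :=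
        setLIntegral_congr_fun measurableSet_Ioo fun t ht =>
          ofReal_one_div_one_sub ht.1.le (ht.2.trans_le hx1)
    _ = ∑' m : ℕ, ∫⁻ t in Ioo 0 x, ENNReal.ofReal (t ^ m) :=
        lintegral_tsum fun m => (measurable_ofReal_pow m).aemeasurable
    _ = ellE x := tsum_congr fun m => lintegral_pow_Ioo m hx0

/-- `Λ_{1}^1(x) = ℓ(x)`. [folklore] -/
theorem wordLI_true {x : ℝ} (hx0 : 0 ≤ x) (hx1 : x ≤ 1) : wordLI [true] 1 x = ellE x := by
  rw [wordLI, show (1 : ℕ) = 0 + 1 from rfl, wordLIntegral_cons true [] 0 x]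
  simp_rw [wordLIntegral_zero, mul_one, mzvForm_true]
  exact lintegral_inv_one_sub hx0 hx1

/-- `ℓ(x) = −log(1−x)` for `0 ≤ x < 1`. [folklore] -/
theorem ellE_eq_ofReal {x : ℝ} (hx0 : 0 ≤ x) (hx1 : x < 1) :
    ellE x = ENNReal.ofReal (-Real.log (1 - x)) := by
  have habs : |x| < 1 := abs_lt.mpr ⟨by linarith, hx1⟩
  have hs := Real.hasSum_pow_div_log_of_abs_lt_one habs
  rw [ellE, ← hs.tsum_eq, ENNReal.ofReal_tsum_of_nonneg (fun m => by positivity) hs.summable]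

/-- `ℓ` as a series with separated coefficients: `Σ_m (1/(m+1)) · x^{m+1}`. [folklore] -/
theorem ellE_eq_tsum_mul (x : ℝ) :
    ellE x = ∑' m : ℕ, ENNReal.ofReal (1 / (m + 1)) * ENNReal.ofReal (x ^ (m + 1)) := by
  refine tsum_congr fun m => ?_
  rw [← ENNReal.ofReal_mul (by positivity)]
  congr 1
  ring

/-! ### The letter `0`: `Λ_{01} = Li₂`, `Λ_{001} = Li₃` -/

/-- `Λ_{01}^2(y) = Li₂(y)` for `0 ≤ y ≤ 1`. [folklore] -/
theorem wordLI_false_true {y : ℝ} (hy0 : 0 ≤ y) (hy1 : y ≤ 1) :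
    wordLI [false, true] 2 y = li2E y := by
  rw [wordLI, show (2 : ℕ) = 1 + 1 from rfl, wordLIntegral_cons false [true] 1 y]
  calc ∫⁻ t₀ in Ioo 0 y, ENNReal.ofReal (mzvForm false t₀) * wordLI [true] 1 t₀
      = ∫⁻ t₀ in Ioo 0 y, ENNReal.ofReal (1 / t₀) *
          ∑' m : ℕ, ENNReal.ofReal (1 / (m + 1)) * ENNReal.ofReal (t₀ ^ (m + 1)) :=
        setLIntegral_congr_fun measurableSet_Ioo fun t ht => by
          rw [mzvForm_false, wordLI_true ht.1.le (ht.2.le.trans hy1), ellE_eq_tsum_mul t]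
    _ = li2E y := by
        rw [lintegral_inv_mul_tsum (fun m : ℕ => ENNReal.ofReal (1 / (m + 1))) (fun m => m + 1)
          (fun m => Nat.succ_le_succ (Nat.zero_le m)) hy0]
        refine tsum_congr fun m => ?_
        push_cast
        rfl

/-- `Li₂` with separated coefficients: `Σ_m (1/(m+1)²) · y^{m+1}`. [folklore] -/
theorem li2E_eq_tsum_mul (y : ℝ) :
    li2E y = ∑' m : ℕ, ENNReal.ofReal (1 / (m + 1) ^ 2) * ENNReal.ofReal (y ^ (m + 1)) := by
  refine tsum_congr fun m => ?_
  rw [← ENNReal.ofReal_mul (by positivity), ← ENNReal.ofReal_mul (by positivity)]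
  congr 1
  field_simp

/-- `Λ_{001}^3(x) = Li₃(x)` for `0 ≤ x ≤ 1`. [folklore] -/
theorem wordLI_false_false_true {x : ℝ} (hx0 : 0 ≤ x) (hx1 : x ≤ 1) :
    wordLI [false, false, true] 3 x = li3E x := by
  rw [wordLI, show (3 : ℕ) = 2 + 1 from rfl, wordLIntegral_cons false [false, true] 2 x]
  calc ∫⁻ t₀ in Ioo 0 x, ENNReal.ofReal (mzvForm false t₀) * wordLI [false, true] 2 t₀
      = ∫⁻ t₀ in Ioo 0 x, ENNReal.ofReal (1 / t₀) *
          ∑' m : ℕ, ENNReal.ofReal (1 / (m + 1) ^ 2) * ENNReal.ofReal (t₀ ^ (m + 1)) :=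
        setLIntegral_congr_fun measurableSet_Ioo fun t ht => by
          rw [mzvForm_false, wordLI_false_true ht.1.le (ht.2.le.trans hx1), li2E_eq_tsum_mul t]
    _ = li3E x := by
        rw [lintegral_inv_mul_tsum (fun m : ℕ => ENNReal.ofReal (1 / (m + 1) ^ 2)) (fun m => m + 1)
          (fun m => Nat.succ_le_succ (Nat.zero_le m)) hx0]
        refine tsum_congr fun m => ?_
        push_cast
        rfl

/-! ### The letter `1` again: `Λ_{101} = Li_{1,2}` -/

/-- `Λ_{101}^3(x) = Li_{1,2}(x)` for `0 ≤ x ≤ 1`. [folklore] -/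
theorem wordLI_true_false_true {x : ℝ} (hx0 : 0 ≤ x) (hx1 : x ≤ 1) :
    wordLI [true, false, true] 3 x = li12E x := by
  rw [wordLI, show (3 : ℕ) = 2 + 1 from rfl, wordLIntegral_cons true [false, true] 2 x]
  calc ∫⁻ t₀ in Ioo 0 x, ENNReal.ofReal (mzvForm true t₀) * wordLI [false, true] 2 t₀
      = ∫⁻ t₀ in Ioo 0 x, ENNReal.ofReal (1 / (1 - t₀)) *
          ∑' m : ℕ, ENNReal.ofReal (1 / (m + 1) ^ 2) * ENNReal.ofReal (t₀ ^ (m + 1)) :=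
        setLIntegral_congr_fun measurableSet_Ioo fun t ht => by
          rw [mzvForm_true, wordLI_false_true ht.1.le (ht.2.le.trans hx1), li2E_eq_tsum_mul t]
    _ = li12E x := by
        rw [lintegral_inv_one_sub_mul_tsum (fun m : ℕ => ENNReal.ofReal (1 / (m + 1) ^ 2))
          (fun m => m + 1) hx0 hx1]
        rfl

/-- `Li₂(1) = Σ_m 1/(m+1)²` (the constant `ζ(2)` in `ℝ≥0∞`). [folklore] -/
theorem li2E_one : li2E 1 = ∑' m : ℕ, ENNReal.ofReal (1 / (m + 1) ^ 2) := by
  rw [li2E_eq_tsum_mul 1]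
  simp

/-- `Σ_m 1/(m+1)²` is finite. [folklore] -/
theorem tsum_inv_sq_ne_top : (∑' m : ℕ, ENNReal.ofReal (1 / ((m : ℝ) + 1) ^ 2)) ≠ ∞ := by
  have hs : Summable fun m : ℕ => 1 / ((m : ℝ) + 1) ^ 2 := by
    have := (Real.summable_one_div_nat_pow.mpr one_lt_two)
    simpa [Nat.cast_add, Nat.cast_one] using (summable_nat_add_iff 1).mpr this
  rw [← ENNReal.ofReal_tsum_of_nonneg (fun m => by positivity) hs]
  exact ENNReal.ofReal_ne_top

end Series

end Summit.KontsevichZagierPeriods.Theorems.StuffleInKZ.Negative
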